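import Literature.NumberTheory.Automorphic.BCDTModularity
import Literature.NumberTheory.Automorphic.LangWave0Proofs
import Literature.NumberTheory.EllipticCurves.ZpExtensionProofs
import Literature.NumberTheory.EllipticCurves.BSDConductorProofs
import Literature.NumberTheory.EllipticCurves.TateModuleFinrankProofs
import Literature.NumberTheory.EllipticCurves.TateModuleFinite
import Literature.NumberTheory.EllipticCurves.TateModuleContinuityProofs
import Literature.NumberTheory.EllipticCurves.GaloisActionProofs
import Literature.NumberTheory.DiophantineGeometry.ConductorFactorizationProofs
import Literature.NumberTheory.GaloisRepresentations.ModNCyclotomicCharacter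
import Literature.NumberTheory.GaloisRepresentations.ArtinConductorWildProofs
import Literature.NumberTheory.GaloisRepresentations.RamificationFiltrationHerbrandInverseProofs
import HarnessLib

/-!
# Conrad–Diamond–Taylor Theorem 7.2.4 from Theorems 7.1.2, 7.2.2 and Ogg–Saito (proofs)

Topic `NumberTheory/Automorphic`; a `…Proofs` companion (theorems only: no definitions, no named
facts, no instances) of `Literature.NumberTheory.Automorphic.BCDTModularity`, landed by the tenured
seat of the named fact `Literature.NumberTheory.Automorphic.exists_cuspForm_coeff_eq_frobeniusTrace` (**lang.S33**) as the
next bottom-up step in the printed proof architecture of the Modularity Theorem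
(`Literature.NumberTheory.EllipticCurves.ModularForms.exists_isNewformOf` ⇐ {BCDT Thm. B, CDT Thm. 7.2.4}, Parts 1–3 of
`BCDTModularity`).

B. Conrad, F. Diamond, R. Taylor, *Modularity of certain potentially Barsotti–Tate Galois
representations*, J. Amer. Math. Soc. 12 (1999) [ConradDiamondTaylor1999], p. 556: "Finally, we
record the following strengthening of Theorem 7.2.2, immediate from Theorem 7.1.2: **Theorem
7.2.4.** Let `E/ℚ` be an elliptic curve. If `ρ̄_{E,5}` is modular or `ρ̄_{E,5}|_{ℚ(√5)}` is not
absolutely irreducible, then `E` is modular." Part 4 of `BCDTModularity` vendors the two printed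
inputs as named facts `Literature.NumberTheory.Automorphic.BCDT.CDT_theorem_7_1_2` ("`27 ∤ N_E` ⇒ `E` modular", p. 551) and
`Literature.NumberTheory.Automorphic.BCDT.CDT_theorem_7_2_2` ("`ρ̄_{E,5}|_{ℚ(√5)}` absolutely irreducible and `ρ̄_{E,5}` modular ⇒
`E` modular", p. 553). This file **proves** the deduction

* `Literature.BCDT.CDT_theorem_7_2_4_of_7_1_2_of_7_2_2 :
    CDT_theorem_7_1_2 → CDT_theorem_7_2_2 →
      (∀ W, W.artinConductorExponent_tate_eq_conductorExponent_of_isElliptic 5) → CDT_theorem_7_2_4`,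

the third input being Ogg–Saito in Galois form at `ℓ = 5` (the tree's named fact of
`Literature.NumberTheory.EllipticCurves.HasseWeilAbelian`: the Artin conductor exponent of `V₅ E`
at `v ∤ 5` is the conductor exponent `f_v(E)` of `DiophantineGeometry/Conductor`, Serre–Tate 1968
§2.1, Silverman *ATAEC* IV.10.2 and IV.11.1), and threads it to Theorem A and to **lang.S33**:
`exists_isNewformOf_of_theoremB_of_CDT712_722`,
`Literature.NumberTheory.Automorphic.exists_cuspForm_coeff_eq_frobeniusTrace_of_theoremB_of_CDT712_722` (and the `L`-series
form). Trust base of the Modularity Theorem in the tree after this file: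
{BCDT Thm. B, CDT Thm. 7.1.2, CDT Thm. 7.2.2, Ogg–Saito for `V₅ E` at `3`}.

## The step hidden in "immediate" (the hidden lemma), and its proof here

If `ρ̄_{E,5}|_{ℚ(√5)}` is absolutely irreducible, Theorem 7.2.4 is Theorem 7.2.2. Otherwise one
needs `27 ∤ N_E` to apply Theorem 7.1.2; CDT indicate why in the proof of Lemma 7.2.3 (p. 554:
"using complex conjugation … `ρ̄_{E,5}|_{ℚ(√5)}` is reducible and the image of `ρ̄_{E,5}` has order
`16`"), in the proof of Theorem 7.1.2 (p. 556: "Since `ρ̄_{E',5} ≅ ρ̄_{E,5}`, the conductor of `E'` is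
not divisible by `27`") and in the Introduction (p. 522: `27 ∤ N_E` "if and only if `E` acquires
semistable reduction over a tamely ramified extension of `ℚ₃`"). We prove the contrapositive
"`27 ∣ N_E` ⇒ `ρ̄_{E,5}|_{ℚ(√5)}` absolutely irreducible" in two halves.

* **Arithmetic half** (`exists_orderOf_eq_three_of_dvd_conductorNorm`): `27 ∣ N_E` ⇒ the image
  of `ρ̄_{E,5}` contains an element of order `3`. Indeed `f₃(E) ≥ 3`
  (`WeierstrassCurve.factorization_conductorNorm_holds`), so by Ogg–Saito
  `a₃(V₅ E) = codim (V₅ E)^{I} + Sw₃(V₅ E) ≥ 3 > 2 = dim V₅ E`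
  (`finrank_rationalTateModule_eq_two_holds`), so `V₅ E` is not tame at (the chosen prime `𝔓`
  above) `3` (`GaloisRep.IsTameAt.swanConductorAt_eq_zero`): some `σ` in a wild group `Γ_ℚ^u`,
  `u > 0`, acts non-trivially on `V₅ E = ℚ₅ ⊗ T₅ E`, hence moves a point of some `E[5ⁿ]`
  (`TateModule.proj`). The action of `σ` on the finite `Γ_ℚ`-set `E[5ⁿ]` factors through a finite
  Galois group `Gal(L/ℚ)` (`Literature.NumberTheory.GaloisRepresentations.exists_isGalois_ker_le`), in which `σ` maps into
  `Gal(L/ℚ)^u ≤ G₁(𝔓 ∩ L)` (definition of `absUpperRamificationSubgroup`; `ψ(u) > 0` by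
  `herbrandPhi_herbrandPsi_holds`), a `3`-group (Serre, *Corps locaux* IV §2 Cor. 3:
  `GaloisRep.isPGroup_ramificationSubgroup_comap_one`); so `σ^{3^k}` fixes `E[5ⁿ]`. An
  automorphism of `3`-power order of the `5`-group `E[5ⁿ]` which fixes `E[5]` fixes `E[5ⁿ]`
  (`smul_eq_self_of_pow_smul_eq_self_of_coprime`, induction on the layers), so `σ` moves a point
  of `E[5]`: `ρ̄(σ) ≠ 1` with `ρ̄(σ)^{3^k} = 1`, and a power of it has order `3`.
* **Group-theoretic half** (`isAbsIrreducibleOverSqrt_five_of_orderOf_eq_three`): if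
  `det ρ̄ = χ̄₅` (the Weil pairing, `BCDTModularity` Part 3) and the image of `ρ̄` contains an
  element `g` of order `3`, then `ρ̄|_{Γ_{ℚ(√5)}}` is absolutely irreducible. For let `B ⊇ 𝔽₅` and
  `v ∈ B²` span a `Γ_{ℚ(√5)}`-stable line. Complex conjugation `c` lies in `Γ_{ℚ(√5)}` (`ℚ(√5)`
  is real: `mem_range_absGaloisRestrict_of_isComplexConjugation`), `C = ρ̄(c)` has `C² = 1` and
  `det C = χ̄₅(c) = -1` (`modNCyclotomicCharacter_of_isComplexConjugation`), so `v` is a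
  `C`-eigenvector for `±1` and `C ∓ 1` is a non-zero singular matrix over `𝔽₅`, whose kernel over
  `B` is the line through an `𝔽₅`-rational vector `w₀`; hence `v ∈ B w₀` and `w₀` is a common
  eigenvector of `ρ̄(Γ_{ℚ(√5)})` with `𝔽₅`-rational eigenvalues. The square `T = ρ̄(g)² = ρ̄(g²)`
  lies in `ρ̄(Γ_{ℚ(√5)})` (index `2`: `inv_mul_mem_range_absGaloisRestrict`), `T³ = 1`, `T ≠ 1`,
  and `T w₀ = ν w₀` with `ν³ = 1`, so `ν = 1` in `𝔽₅`; then `S = T - 1` is singular,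
  `S² = tr(S) S` and `1 = T³ = 1 + (t² + 3t + 3) S` with `t = tr S`; as `t² + 3t + 3` has no root
  in `𝔽₅`, `S = 0`, i.e. `T = 1` — a contradiction.

## Inputs (hypotheses of the final theorems; all are named facts of the tree, cited there)

* `Literature.NumberTheory.Automorphic.BCDT.theoremB` (BCDT 2001, Thm. B = Thm. 2.2.1), `Literature.NumberTheory.Automorphic.BCDT.CDT_theorem_7_1_2`,
  `Literature.NumberTheory.Automorphic.BCDT.CDT_theorem_7_2_2` (CDT 1999, Thms. 7.1.2, 7.2.2) — `BCDTModularity`;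
* `WeierstrassCurve.artinConductorExponent_tate_eq_conductorExponent_of_isElliptic W 5`
  (Ogg–Saito in Galois form; `HasseWeilAbelian`).

Everything else used is proved in the tree: the Weil pairing (`det ρ̄_{E,5} = χ̄₅`,
`WeierstrassCurve.det_eq_modPCyclotomicCharacter_of_isTorsionGaloisRep_holds`), `#E[n] = n²` and
open stabilisers (`GaloisActionProofs`), the structure and continuity of `T₅ E`, `V₅ E`
(`TateModule*Proofs`), `N_E = ∏ p^{f_p}` and the `𝓞 ℚ`/`ℤ` bridge (`Conductor*Proofs`), the
Herbrand inverse `φ ∘ ψ = id`, `G₁` is a `p`-group (`RamificationFiltration*Proofs`,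
`ArtinConductorWildProofs`), and the index-`2`/complex-conjugation calculus of
`absGaloisRestrict` (`ZpExtensionProofs`, `AbsGaloisGroup`, `ModNCyclotomicCharacter`).

## References

* [ConradDiamondTaylor1999] B. Conrad, F. Diamond, R. Taylor, J. Amer. Math. Soc. 12 (1999),
  521–567: Introduction (p. 522), Thm. 7.1.2 (p. 551), Thm. 7.2.2 (p. 553), proof of Lemma 7.2.3
  (p. 554), proof of Thm. 7.1.2 and Thm. 7.2.4 (p. 556).
* [BCDTJAMS2001] C. Breuil, B. Conrad, F. Diamond, R. Taylor, J. Amer. Math. Soc. 14 (2001),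
  843–939: Thm. A, Thm. 2.2.2, Introduction.
* [SerreTate1968] J.-P. Serre, J. Tate, *Good reduction of abelian varieties*, Ann. of Math. 88
  (1968), §2.1, §3.
* [SilvermanATAEC1994] J. H. Silverman, *Advanced Topics in the Arithmetic of Elliptic Curves*,
  IV.10 (Thm. 10.2), IV.11 (Thm. 11.1, Ogg's formula).
* [SerreLocalFields1979] J.-P. Serre, *Local Fields*, Ch. IV §2 (Cor. 3 of Prop. 7), §3.
* [SilvermanAEC2009] J. H. Silverman, *The Arithmetic of Elliptic Curves*, III.6.4, III.7, III.8.

## Design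

Pure theorems; `noncomputable section`; one universe `u`; namespaces `Literature.BCDT` (next to the
named facts it serves) and `Literature.Lang` (the lang.S33 corollaries, next to Parts 2–5 of
`LangWave0Proofs`); no instances, no `sorry`. Axioms of every theorem: `propext`,
`Classical.choice`, `Quot.sound`.
-/

noncomputable section

open scoped NumberField MatrixGroups TensorProduct Polynomial
open Field IsDedekindDomain Matrix Polynomial

universe u

namespace Literature.NumberTheory.Automorphic.BCDT

/-! ## The real quadratic field `ℚ(√5)` -/

section SqrtFive

/-- `X² - 5` is irreducible over `ℚ` (`5` is not a rational square). [folklore] -/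
theorem irreducible_X_pow_two_sub_C_five : Irreducible (X ^ 2 - C (5 : ℚ)) := by
  refine X_pow_sub_C_irreducible_of_prime Nat.prime_two fun b hb ↦ ?_
  have h : IsSquare ((5 : ℕ) : ℚ) := ⟨b, by rw [← pow_two, hb]; norm_num⟩
  rw [Rat.isSquare_natCast_iff] at h
  obtain ⟨r, hr⟩ := h
  have hr2 : r ≤ 2 := by nlinarith
  interval_cases r <;> omega

variable (L : Type*) [Field L] [Algebra ℚ L] [IsSplittingField ℚ L (X ^ 2 - C (5 : ℚ))]

/-- A splitting field of `X² - 5` over `ℚ` has degree `2`. [folklore] -/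
theorem finrank_eq_two_of_isSplittingField : Module.finrank ℚ L = 2 := by
  set p : ℚ[X] := X ^ 2 - C (5 : ℚ) with hp
  have hp0 : p ≠ 0 := (irreducible_X_pow_two_sub_C_five).ne_zero
  have hmonic : p.Monic := by rw [hp]; exact monic_X_pow_sub_C _ two_ne_zero
  have hdeg : p.natDegree = 2 := by rw [hp]; exact natDegree_X_pow_sub_C
  haveI : FiniteDimensional ℚ L := IsSplittingField.finiteDimensional L p
  haveI : Algebra.IsIntegral ℚ L := Algebra.IsIntegral.of_finite ℚ L
  -- a root `α ∈ L`
  have hsplit := IsSplittingField.splits L p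
  obtain ⟨α, hα⟩ : ∃ α : L, aeval α p = 0 := by
    have hd : (p.map (algebraMap ℚ L)).degree ≠ 0 := by
      rw [degree_map, degree_eq_natDegree hp0, hdeg]; decide
    obtain ⟨α, hα⟩ := hsplit.exists_eval_eq_zero hd
    exact ⟨α, by rwa [aeval_def, eval₂_eq_eval_map]⟩
  have hα2 : α ^ 2 = 5 := by
    have := hα; rw [hp, map_sub, map_pow, aeval_X, aeval_C, sub_eq_zero] at this
    simpa using this
  -- every root is `±α`, so `L = ℚ(α)`
  have hroots : p.rootSet L ⊆ (IntermediateField.adjoin ℚ {α} : Set L) := by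
    intro β hβ
    rw [mem_rootSet] at hβ
    have hβ2 : β ^ 2 = 5 := by
      have := hβ.2; rw [hp, map_sub, map_pow, aeval_X, aeval_C, sub_eq_zero] at this
      simpa using this
    have hαmem : α ∈ IntermediateField.adjoin ℚ {α} := IntermediateField.mem_adjoin_simple_self ℚ α
    have : (β - α) * (β + α) = 0 := by ring_nf; rw [hβ2, hα2]; ring
    rcases mul_eq_zero.mp this with h | h
    · rw [sub_eq_zero.mp h]; exact hαmem
    · rw [eq_neg_of_add_eq_zero_left h]; exact neg_mem hαmem
  have htop : IntermediateField.adjoin ℚ {α} = ⊤ := by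
    rw [← IntermediateField.toSubalgebra_injective.eq_iff, IntermediateField.top_toSubalgebra,
      ← IsSplittingField.adjoin_rootSet L p]
    refine le_antisymm ?_ (Algebra.adjoin_le hroots)
    rw [IntermediateField.adjoin_simple_toSubalgebra_of_isAlgebraic
      (Algebra.IsAlgebraic.isAlgebraic α)]
    refine Algebra.adjoin_mono ?_
    rw [Set.singleton_subset_iff, mem_rootSet]
    exact ⟨hp0, hα⟩
  have hmin : minpoly ℚ α = p := (minpoly.eq_of_irreducible_of_monic
    irreducible_X_pow_two_sub_C_five hα hmonic).symm
  rw [← IntermediateField.finrank_top', ← htop,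
    IntermediateField.adjoin.finrank (Algebra.IsIntegral.isIntegral α), hmin, hdeg]

/-- Complex conjugation fixes the square roots of `5` in `ℚ̄` (they are real). [folklore] -/
theorem smul_eq_self_of_sq_eq_five {φ : ℚ →+* ℝ} {c : absoluteGaloisGroup ℚ}
    (hc : GaloisRepresentations.IsComplexConjugation φ c) {s : AlgebraicClosure ℚ} (hs : s ^ 2 = 5) : c • s = s := by
  obtain ⟨ι, -, hι⟩ := GaloisRepresentations.isComplexConjugation_iff.mp hc
  apply ι.injective
  rw [hι, Complex.conj_eq_iff_im]
  set z := ι s with hz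
  have hz2 : z ^ 2 = 5 := by rw [hz, ← map_pow, hs, map_ofNat]
  have hre : z.re * z.re - z.im * z.im = 5 := by
    have := congrArg Complex.re hz2; simpa [pow_two, Complex.mul_re] using this
  have him : z.re * z.im + z.im * z.re = 0 := by
    have := congrArg Complex.im hz2; simpa [pow_two, Complex.mul_im] using this
  nlinarith [mul_self_nonneg z.im, mul_self_nonneg z.re]

/-- Complex conjugation lies in the image of `Γ_{ℚ(√5)} → Γ_ℚ` (`ℚ(√5)` is real). [folklore] -/
theorem mem_range_absGaloisRestrict_of_isComplexConjugation {φ : ℚ →+* ℝ}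
    {c : absoluteGaloisGroup ℚ} (hc : GaloisRepresentations.IsComplexConjugation φ c) :
    c ∈ Set.range (GaloisRepresentations.absGaloisRestrict ℚ L) := by
  haveI : FiniteDimensional ℚ L := IsSplittingField.finiteDimensional L (X ^ 2 - C (5 : ℚ))
  rw [EllipticCurves.mem_range_absGaloisRestrict_iff]
  set T := EllipticCurves.absGaloisTransport (K := ℚ) (L := L) c with hT
  suffices h : ∀ x ∈ Algebra.adjoin ℚ ((X ^ 2 - C (5 : ℚ)).rootSet L),
      T (algebraMap L (AlgebraicClosure L) x) = algebraMap L (AlgebraicClosure L) x by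
    intro x
    exact h x (by rw [IsSplittingField.adjoin_rootSet L (X ^ 2 - C (5 : ℚ))]; trivial)
  intro x hx
  induction hx using Algebra.adjoin_induction with
  | mem x hx =>
    rw [mem_rootSet] at hx
    have hx2 : x ^ 2 = 5 := by
      have := hx.2; rw [map_sub, map_pow, aeval_X, aeval_C, sub_eq_zero] at this
      simpa using this
    have hs : ((EllipticCurves.absClosureEquiv ℚ L).symm (algebraMap L (AlgebraicClosure L) x)) ^ 2 = 5 := by
      rw [← map_pow, ← map_pow, hx2, map_ofNat, map_ofNat]
    rw [hT, EllipticCurves.absGaloisTransport_apply, smul_eq_self_of_sq_eq_five hc hs, AlgEquiv.apply_symm_apply]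
  | algebraMap r =>
    rw [← IsScalarTower.algebraMap_apply, AlgEquiv.commutes]
  | add x y _ _ hx hy => rw [map_add, map_add, hx, hy]
  | mul x y _ _ hx hy => rw [map_mul, map_mul, hx, hy]

/-- The image of `Γ_{ℚ(√5)} → Γ_ℚ` has index `≤ 2`, so it contains all squares. [folklore] -/
theorem sq_mem_range_absGaloisRestrict (g : absoluteGaloisGroup ℚ) :
    g ^ 2 ∈ Set.range (GaloisRepresentations.absGaloisRestrict ℚ L) := by
  haveI : FiniteDimensional ℚ L := IsSplittingField.finiteDimensional L (X ^ 2 - C (5 : ℚ))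
  by_cases hg : g ∈ Set.range (GaloisRepresentations.absGaloisRestrict ℚ L)
  · obtain ⟨x, rfl⟩ := hg
    exact ⟨x ^ 2, map_pow _ _ _⟩
  · have hg' : g⁻¹ ∉ Set.range (GaloisRepresentations.absGaloisRestrict ℚ L) := by
      rintro ⟨x, hx⟩
      exact hg ⟨x⁻¹, by rw [map_inv, hx, inv_inv]⟩
    have := EllipticCurves.inv_mul_mem_range_absGaloisRestrict (finrank_eq_two_of_isSplittingField L) hg' hg
    rwa [inv_inv, ← pow_two] at this

end SqrtFive

/-! ## An element of order `3` in the image forces absolute irreducibility over `ℚ(√5)` -/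

section OrderThree

/-- `x³ = 1` in `𝔽₅` forces `x = 1` (`#𝔽₅ˣ = 4` is prime to `3`). [folklore] -/
theorem zmod_five_eq_one_of_pow_three_eq_one (x : ZMod 5) (h : x ^ 3 = 1) : x = 1 := by
  revert x; decide

/-- `t² + 3t + 3` has no root in `𝔽₅` (its discriminant `-3 ≡ 2` is a non-square). [folklore] -/
theorem zmod_five_sq_add_three_mul_add_three_ne_zero (t : ZMod 5) : t ^ 2 + 3 * t + 3 ≠ 0 := by
  revert t; decide

/-- Cayley–Hamilton for a singular `2 × 2` matrix: `S² = tr(S) S`. [folklore] -/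
theorem mul_self_eq_trace_smul_of_det_eq_zero {R : Type*} [CommRing R]
    (S : Matrix (Fin 2) (Fin 2) R) (h : S.det = 0) : S * S = S.trace • S := by
  obtain ⟨a, b, c, d, rfl⟩ : ∃ a b c d : R, S = !![a, b; c, d] := ⟨_, _, _, _, Matrix.eta_fin_two S⟩
  rw [Matrix.det_fin_two_of] at h
  rw [Matrix.trace_fin_two_of, Matrix.mul_fin_two]
  ext i j
  fin_cases i <;> fin_cases j <;> simp <;>
    first | ring1 | linear_combination h | linear_combination -h

/-- An element `T` of `M₂(𝔽₅)` with `T³ = 1` and an eigenvector is the identity. [folklore] -/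
theorem eq_one_of_pow_three_eq_one_of_mulVec_eq_smul (T : Matrix (Fin 2) (Fin 2) (ZMod 5))
    {w : Fin 2 → ZMod 5} {μ : ZMod 5} (hw : w ≠ 0) (hT : T *ᵥ w = μ • w) (h3 : T ^ 3 = 1) :
    T = 1 := by
  -- the eigenvalue is a cube root of unity, hence `1`
  have hμ : μ = 1 := by
    refine zmod_five_eq_one_of_pow_three_eq_one μ ?_
    have h' : (T ^ 3) *ᵥ w = μ ^ 3 • w := by
      simp only [pow_succ, pow_zero, one_mul, ← mulVec_mulVec, hT, mulVec_smul, smul_smul]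
      ring_nf
    rw [h3, one_mulVec] at h'
    have h'' : (μ ^ 3 - 1) • w = 0 := by rw [sub_smul, one_smul, ← h', sub_self]
    rcases smul_eq_zero.mp h'' with h0 | h0
    · exact (sub_eq_zero.mp h0)
    · exact absurd h0 hw
  subst hμ
  rw [one_smul] at hT
  -- `S = T - 1` is singular
  set S : Matrix (Fin 2) (Fin 2) (ZMod 5) := T - 1 with hS
  have hSw : S *ᵥ w = 0 := by rw [hS, sub_mulVec, one_mulVec, hT, sub_self]
  have hdet : S.det = 0 := Matrix.exists_mulVec_eq_zero_iff.mp ⟨w, hw, hSw⟩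
  have hS2 : S * S = S.trace • S := mul_self_eq_trace_smul_of_det_eq_zero S hdet
  have hT' : T = 1 + S := by rw [hS, add_sub_cancel]
  set t := S.trace with ht
  have hcube : T ^ 3 = 1 + (t ^ 2 + 3 * t + 3) • S := by
    rw [hT']
    have h2 : (1 + S) * (1 + S) = 1 + (2 + t) • S := by
      rw [add_mul, one_mul, mul_add, mul_one, hS2]; module
    rw [pow_succ, pow_two, h2, add_mul, one_mul, mul_add, mul_one, smul_mul_assoc, hS2, smul_smul]
    module
  rw [h3] at hcube
  have hzero : (t ^ 2 + 3 * t + 3) • S = 0 := by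
    have := congrArg (fun M => M - 1) hcube
    simpa using this.symm
  rcases smul_eq_zero.mp hzero with h0 | h0
  · exact absurd h0 (zmod_five_sq_add_three_mul_add_three_ne_zero t)
  · rw [hT', h0, add_zero]


/-- Descent of an eigenvalue equation along a field embedding: if `f ∘ u = μ • (f ∘ w₀)` with
`w₀ ≠ 0` then `u = ν • w₀` for some scalar `ν` of the small field. [folklore] -/
theorem exists_eq_smul_of_comp_eq_smul_comp {k B : Type*} [Field k] [Field B] (f : k →+* B)
    {u w₀ : Fin 2 → k} {μ : B} (hw₀ : w₀ ≠ 0) (h : f ∘ u = μ • (f ∘ w₀)) :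
    ∃ ν : k, u = ν • w₀ := by
  obtain ⟨i, hi⟩ : ∃ i, w₀ i ≠ 0 := Function.ne_iff.mp hw₀
  have hi' : f (u i) = μ * f (w₀ i) := by simpa using congrFun h i
  refine ⟨u i / w₀ i, funext fun j ↦ f.injective ?_⟩
  have hj : f (u j) = μ * f (w₀ j) := by simpa using congrFun h j
  rw [Pi.smul_apply, smul_eq_mul, map_mul, map_div₀, hj, hi', mul_div_assoc,
    div_self ((map_ne_zero f).mpr hi), mul_one]

/-- **The hidden lemma of CDT Thm. 7.2.4, group-theoretic half.** Let `ρ̄ : Γ_ℚ → GL₂(𝔽₅)` be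
continuous with cyclotomic determinant. If the image of `ρ̄` contains an element of order `3`,
then `ρ̄|_{Γ_{ℚ(√5)}}` is absolutely irreducible. (Conrad–Diamond–Taylor 1999, proof of
Lemma 7.2.3, p. 554: "using complex conjugation ... `ρ̄_{E,5}|_{ℚ(√5)}` is reducible and the image
of `ρ̄_{E,5}` has order `16`" in the non-absolutely-irreducible case.) Proof: a stable line for
`Γ_{ℚ(√5)}` over any extension `B ⊇ 𝔽₅` is an eigenline of the image `C` of complex conjugation
(`c ∈ Γ_{ℚ(√5)}` as `ℚ(√5)` is real; `C² = 1`, `det C = χ̄₅(c) = -1`), hence `𝔽₅`-rational; the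
square `T` of the element of order `3` lies in the image of `Γ_{ℚ(√5)}` (index `2`), has order `3`
and an `𝔽₅`-rational eigenvector, which forces `T = 1` in `GL₂(𝔽₅)`. [folklore] -/
theorem isAbsIrreducibleOverSqrt_five_of_orderOf_eq_three (ρ : GaloisRepresentations.ModPGaloisRep ℚ (ZMod 5) 2)
    (hdet : ∀ σ : absoluteGaloisGroup ℚ,
      Matrix.GeneralLinearGroup.det (ρ σ) = GaloisRepresentations.modPCyclotomicCharacterZMod ℚ 5 σ)
    {σ₀ : absoluteGaloisGroup ℚ} (h3 : orderOf (ρ σ₀) = 3) :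
    ρ.IsAbsIrreducibleOverSqrt 5 := by
  intro L _ _ _ B _ f
  classical
  set r := GaloisRepresentations.absGaloisRestrict ℚ L with hr
  -- the matrices `A g = ρ̄(g) ∈ M₂(𝔽₅)`
  set A : absoluteGaloisGroup ℚ → Matrix (Fin 2) (Fin 2) (ZMod 5) :=
    fun g ↦ ((ρ g : GL (Fin 2) (ZMod 5)) : Matrix (Fin 2) (Fin 2) (ZMod 5)) with hA
  have hAmul : ∀ g h, A (g * h) = A g * A h := fun g h ↦ by
    simp only [hA, map_mul, Units.val_mul]
  have hAone : A 1 = 1 := by simp only [hA, map_one, Units.val_one]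
  set ρ' := (GaloisRepresentations.FramedGaloisRep.restrictField L ρ).baseChangeRepresentation f with hρ'def
  have hρ' : ∀ (g : absoluteGaloisGroup L) (v : Fin 2 → B), ρ' g v = (A (r g)).map f *ᵥ v := by
    intro g v
    rw [hρ'def, GaloisRepresentations.FramedRep.baseChangeRepresentation_apply_apply, GaloisRepresentations.FramedGaloisRep.restrictField_apply]
    rfl
  -- non-triviality of the lattice of subrepresentations
  haveI : Nontrivial (Subrepresentation ρ') := by
    refine ⟨⟨⊥, ⊤, fun h ↦ ?_⟩⟩
    have h' := congrArg Subrepresentation.toSubmodule h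
    exact bot_ne_top (α := Submodule B (Fin 2 → B)) h'
  refine ⟨fun S ↦ ?_⟩
  rcases eq_or_ne S ⊥ with h | hSbot
  · exact Or.inl h
  rcases eq_or_ne S ⊤ with h | hStop
  · exact Or.inr h
  exfalso
  -- `U = S` is a line `B ∙ v`
  set U : Submodule B (Fin 2 → B) := S.toSubmodule with hU
  have hUbot : U ≠ ⊥ := fun h ↦ hSbot (Subrepresentation.toSubmodule_injective h)
  have hUtop : U ≠ ⊤ := fun h ↦ hStop (Subrepresentation.toSubmodule_injective h)
  have hfin2 : Module.finrank B (Fin 2 → B) = 2 := by simp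
  have hU1 : Module.finrank B U = 1 := by
    have hlt : Module.finrank B U < Module.finrank B (Fin 2 → B) :=
      Submodule.finrank_lt hUtop
    have hpos : Module.finrank B U ≠ 0 := fun h ↦ hUbot (Submodule.finrank_eq_zero.mp h)
    omega
  obtain ⟨v, hvU, hv⟩ := Submodule.exists_mem_ne_zero_of_ne_bot hUbot
  have hUspan : U = B ∙ v := by
    refine (Submodule.eq_of_le_of_finrank_eq ((Submodule.span_singleton_le_iff_mem v U).mpr hvU)
      ?_).symm
    rw [finrank_span_singleton hv, hU1]
  -- `v` is a common eigenvector of `ρ̄(Γ_L)`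
  have heig : ∀ g : absoluteGaloisGroup L, ∃ μ : B, (A (r g)).map f *ᵥ v = μ • v := by
    intro g
    have hmem : ρ' g v ∈ U := S.apply_mem_toSubmodule g hvU
    rw [hρ', hUspan, Submodule.mem_span_singleton] at hmem
    obtain ⟨μ, hμ⟩ := hmem
    exact ⟨μ, hμ.symm⟩
  -- complex conjugation `c₀ = r c`, `C = ρ̄(c₀)`: `C² = 1`, `det C = -1`
  obtain ⟨c₀, hc₀⟩ := GaloisRepresentations.exists_isComplexConjugation (Rat.castHom ℝ)
  obtain ⟨c, hc⟩ := mem_range_absGaloisRestrict_of_isComplexConjugation L hc₀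
  set C := A c₀ with hC
  have hC2 : C * C = 1 := by
    rw [hC, ← hAmul, ← pow_two, hc₀.sq_eq_one, hAone]
  have hdetC : C.det = -1 := by
    have h1 := congrArg (fun u : (ZMod 5)ˣ ↦ (u : ZMod 5)) (hdet c₀)
    simp only [Matrix.GeneralLinearGroup.val_det_apply] at h1
    rw [hC, hA, h1, GaloisRepresentations.modPCyclotomicCharacterZMod_eq_modNCyclotomicCharacter]
    exact GaloisRepresentations.modNCyclotomicCharacter_of_isComplexConjugation (N := 5) hc₀
  obtain ⟨μc, hμc⟩ := heig c
  rw [hc] at hμc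
  -- `μc = ±1`
  have hμc2 : μc * μc = 1 := by
    have h1 : (C.map f) *ᵥ ((C.map f) *ᵥ v) = (μc * μc) • v := by
      rw [hμc, mulVec_smul, hμc, smul_smul]
    rw [mulVec_mulVec, ← Matrix.map_mul, hC2, Matrix.map_one f (map_zero f) (map_one f),
      one_mulVec] at h1
    have h2 : (μc * μc - 1) • v = 0 := by rw [sub_smul, one_smul, ← h1, sub_self]
    rcases smul_eq_zero.mp h2 with h | h
    · exact (sub_eq_zero.mp h)
    · exact absurd h hv
  obtain ⟨μ₀, hμ₀⟩ : ∃ μ₀ : ZMod 5, f μ₀ = μc ∧ μ₀ ^ 2 = 1 := by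
    rcases mul_self_eq_one_iff.mp hμc2 with h | h
    · exact ⟨1, by rw [map_one, h], one_pow 2⟩
    · exact ⟨-1, by rw [map_neg, map_one, h], by ring⟩
  -- `N = C - μ₀` is a non-zero singular matrix over `𝔽₅`
  set N : Matrix (Fin 2) (Fin 2) (ZMod 5) := C - μ₀ • (1 : Matrix (Fin 2) (Fin 2) (ZMod 5))
    with hN
  have hNf : N.map f = C.map f - μc • (1 : Matrix (Fin 2) (Fin 2) B) := by
    ext i j
    by_cases hij : i = j
    · subst hij; simp [hN, Matrix.map_apply, hμ₀.1]
    · simp [hN, Matrix.map_apply, hij]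
  have hNv : N.map f *ᵥ v = 0 := by
    rw [hNf, sub_mulVec, smul_mulVec, one_mulVec, hμc, sub_self]
  have hdetN : N.det = 0 := by
    have h1 : (N.map f).det = 0 := Matrix.exists_mulVec_eq_zero_iff.mp ⟨v, hv, hNv⟩
    have h2 : f N.det = 0 := by rw [RingHom.map_det, RingHom.mapMatrix_apply, h1]
    exact (map_eq_zero f).mp h2
  have hN0 : N ≠ 0 := by
    intro h0
    have hCeq : C = μ₀ • (1 : Matrix (Fin 2) (Fin 2) (ZMod 5)) := sub_eq_zero.mp (hN ▸ h0)
    have : C.det = 1 := by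
      rw [hCeq, Matrix.det_smul, Matrix.det_one, mul_one, Fintype.card_fin, hμ₀.2]
    rw [hdetC] at this
    exact absurd this (by decide)
  -- an `𝔽₅`-rational kernel vector `w₀` of `N`; over `B` the kernel is the line through it
  obtain ⟨w₀, hw₀, hNw₀⟩ := Matrix.exists_mulVec_eq_zero_iff.mpr hdetN
  set w : Fin 2 → B := f ∘ w₀ with hw
  have hw0 : w ≠ 0 := by
    obtain ⟨i, hi⟩ : ∃ i, w₀ i ≠ 0 := Function.ne_iff.mp hw₀
    intro h0
    exact hi ((map_eq_zero f).mp (by simpa [hw] using congrFun h0 i))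
  have hmapvec : ∀ M : Matrix (Fin 2) (Fin 2) (ZMod 5), M.map f *ᵥ w = f ∘ (M *ᵥ w₀) := by
    intro M
    funext i
    rw [hw, Function.comp_apply, RingHom.map_mulVec]
  have hNw : N.map f *ᵥ w = 0 := by
    rw [hmapvec, hNw₀]; funext i; simp
  set φN := (N.map f).mulVecLin with hφN
  have hker1 : Module.finrank B (LinearMap.ker φN) = 1 := by
    have hsum := LinearMap.finrank_range_add_finrank_ker φN
    rw [hfin2] at hsum
    have hrange : Module.finrank B (LinearMap.range φN) ≠ 0 := by
      intro h0
      rw [Submodule.finrank_eq_zero, LinearMap.range_eq_bot] at h0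
      apply hN0
      ext i j
      have hij : (N.map f *ᵥ Pi.single j 1) i = 0 := by
        have := congrArg (fun g ↦ g (Pi.single j 1) i) h0
        simpa [hφN] using this
      rw [mulVec_single_one] at hij
      simpa [Matrix.map_apply] using hij
    have hkerpos : Module.finrank B (LinearMap.ker φN) ≠ 0 := by
      intro h0
      rw [Submodule.finrank_eq_zero] at h0
      have : w ∈ LinearMap.ker φN := by rw [LinearMap.mem_ker, hφN, mulVecLin_apply, hNw]
      rw [h0, Submodule.mem_bot] at this
      exact hw0 this
    omega
  have hker : LinearMap.ker φN = B ∙ w := by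
    have hwmem : w ∈ LinearMap.ker φN := by rw [LinearMap.mem_ker, hφN, mulVecLin_apply, hNw]
    refine (Submodule.eq_of_le_of_finrank_eq
      ((Submodule.span_singleton_le_iff_mem w _).mpr hwmem) ?_).symm
    rw [finrank_span_singleton hw0, hker1]
  obtain ⟨lam, hlam⟩ : ∃ lam : B, lam • w = v := by
    have hvker : v ∈ LinearMap.ker φN := by rw [LinearMap.mem_ker, hφN, mulVecLin_apply, hNv]
    rw [hker, Submodule.mem_span_singleton] at hvker
    exact hvker
  have hlam0 : lam ≠ 0 := by
    rintro rfl
    rw [zero_smul] at hlam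
    exact hv hlam.symm
  -- hence `w₀` is a common `𝔽₅`-rational eigenvector of `ρ̄(Γ_L)`
  have heig₀ : ∀ g : absoluteGaloisGroup L, ∃ ν : ZMod 5, A (r g) *ᵥ w₀ = ν • w₀ := by
    intro g
    obtain ⟨μ, hμ⟩ := heig g
    have hμw : (A (r g)).map f *ᵥ w = μ • w := by
      apply smul_right_injective (Fin 2 → B) hlam0
      change lam • ((A (r g)).map f *ᵥ w) = lam • (μ • w)
      rw [← mulVec_smul, hlam, hμ, smul_comm, hlam]
    rw [hmapvec] at hμw
    exact exists_eq_smul_of_comp_eq_smul_comp f hw₀ hμw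
  -- the square of the element of order `3` lies in the image of `Γ_L`
  obtain ⟨g₁, hg₁⟩ := sq_mem_range_absGaloisRestrict L σ₀
  obtain ⟨ν, hν⟩ := heig₀ g₁
  have hT : A (r g₁) = A σ₀ ^ 2 := by
    change A (GaloisRepresentations.absGaloisRestrict ℚ L g₁) = _
    rw [hg₁, pow_two, pow_two, hAmul]
  have hT3 : (A σ₀ ^ 2) ^ 3 = 1 := by
    rw [← pow_mul, mul_comm, pow_mul]
    have : A σ₀ ^ 3 = 1 := by
      rw [hA]
      change ((ρ σ₀ : GL (Fin 2) (ZMod 5)) : Matrix (Fin 2) (Fin 2) (ZMod 5)) ^ 3 = 1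
      rw [← Units.val_pow_eq_pow_val, ← h3, pow_orderOf_eq_one, Units.val_one]
    rw [this, one_pow]
  rw [hT] at hν
  have hT1 : A σ₀ ^ 2 = 1 := eq_one_of_pow_three_eq_one_of_mulVec_eq_smul _ hw₀ hν hT3
  have hne : (ρ σ₀) ^ 2 ≠ 1 := pow_ne_one_of_lt_orderOf two_ne_zero (by rw [h3]; norm_num)
  apply hne
  ext1
  rw [Units.val_pow_eq_pow_val, Units.val_one]
  exact hT1

end OrderThree


/-! ## Wild ramification: from the Artin conductor to an element of `p`-power order -/

/-- If the Artin conductor exponent of a finite-dimensional Galois representation `ρ` at `v`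
exceeds `dim ρ`, then some element of some wild ramification group `Γ_K^u` (`u > 0`, at the prime
`𝔓 ∣ v` used to compute the exponent) acts non-trivially: otherwise `ρ` is tame at `𝔓`, its Swan
conductor vanishes and `a_v(ρ) = codim ρ^{I} ≤ dim ρ`. [folklore] -/
theorem exists_mem_absUpperRamificationSubgroup_ne_one {K : Type*} [Field K] [NumberField K]
    {A : Type*} [Field A] [TopologicalSpace A] {M : Type*} [AddCommGroup M] [Module A M]
    [TopologicalSpace M] [FiniteDimensional A M] (ρ : GaloisRepresentations.GaloisRep K A M) (v : HeightOneSpectrum (𝓞 K))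
    (h : Module.finrank A M < ρ.artinConductorExponent v) :
    ∃ u : ℝ, 0 < u ∧ ∃ σ ∈ GaloisRepresentations.absUpperRamificationSubgroup (𝓞 K)
      (HeightOneSpectrum.primesAbove_nonempty v).some u, ρ σ ≠ 1 := by
  by_contra hall
  have htame : ρ.IsTameAt (𝓞 K) (HeightOneSpectrum.primesAbove_nonempty v).some := by
    intro u hu σ hσ
    by_contra hne
    exact hall ⟨u, hu, σ, hσ, hne⟩
  have hsw := htame.swanConductorAt_eq_zero
  have hle : ρ.artinConductorExponent v ≤ Module.finrank A M := by
    unfold GaloisRepresentations.GaloisRep.artinConductorExponent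
    rw [GaloisRepresentations.GaloisRep.artinConductorAt_def, hsw, add_zero, Nat.floor_natCast]
    exact Submodule.finrank_quotient_le _
  omega

/-- An element of a wild ramification group `Γ_K^u`, `u > 0`, at a prime `𝔓 ∣ v ∣ p`, acts on any
`Γ_K`-set `X` whose pointwise stabiliser is open (e.g. a finite discrete `Γ_K`-set) through an
element of `p`-power order: the action factors through a finite Galois group `Gal(E/K)`
(`Literature.NumberTheory.GaloisRepresentations.exists_isGalois_ker_le`), in which the image of `Γ_K^u` lies in
`Gal(E/K)^u ≤ G_1(𝔓 ∩ E)`, a `p`-group (Serre, *Local Fields*, IV §2, Cor. 3 of Prop. 7). [folklore] -/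
theorem exists_pow_prime_pow_smul_eq_self {K : Type*} [Field K] [NumberField K]
    {v : HeightOneSpectrum (𝓞 K)} {𝔓 : Ideal (GaloisRepresentations.absIntegers (𝓞 K) K)} (h𝔓 : 𝔓 ∈ v.primesAbove)
    {p : ℕ} (hpv : (p : 𝓞 K) ∈ v.asIdeal) {u : ℝ} (hu : 0 < u) {σ : absoluteGaloisGroup K}
    (hσ : σ ∈ GaloisRepresentations.absUpperRamificationSubgroup (𝓞 K) 𝔓 u) (X : Type*)
    [MulAction (absoluteGaloisGroup K) X]
    (hopen : IsOpen {τ : absoluteGaloisGroup K | ∀ x : X, τ • x = x}) :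
    ∃ k : ℕ, ∀ x : X, σ ^ p ^ k • x = x := by
  classical
  -- the permutation representation on `X`, continuous for the discrete topology
  letI : TopologicalSpace (Equiv.Perm X) := ⊥
  haveI : DiscreteTopology (Equiv.Perm X) := ⟨rfl⟩
  let f₀ : absoluteGaloisGroup K →* Equiv.Perm X := MulAction.toPermHom _ X
  have hf₀ : ∀ τ : absoluteGaloisGroup K, (∀ x : X, τ • x = x) → f₀ τ = 1 := fun τ hτ ↦
    Equiv.ext fun x ↦ by simpa [f₀] using hτ x
  have hcont : Continuous f₀ := by
    refine continuous_of_continuousAt_one f₀ ?_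
    rw [ContinuousAt, map_one]
    refine (tendsto_const_nhds (x := (1 : Equiv.Perm X))).congr' ?_
    have h1 : (1 : absoluteGaloisGroup K) ∈ {τ : absoluteGaloisGroup K | ∀ x : X, τ • x = x} :=
      fun x ↦ one_smul _ x
    filter_upwards [hopen.mem_nhds h1] with τ hτ
    exact (hf₀ τ hτ).symm
  obtain ⟨E, hEfd, hEgal, hker⟩ :=
    GaloisRepresentations.exists_isGalois_ker_le K (⟨f₀, hcont⟩ : absoluteGaloisGroup K →ₜ* Equiv.Perm X)
  haveI := hEfd
  haveI := hEgal
  -- the restriction of `σ` to `E` lies in `G_1(𝔓 ∩ E)`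
  set 𝔓E := 𝔓.comap (E.integralClosureToAbsIntegers (𝓞 K)) with h𝔓E
  have hs : GaloisRepresentations.absRestrictNormalHom E σ ∈ GaloisRepresentations.upperRamificationSubgroup 𝔓E (E ≃ₐ[K] E) u :=
    (GaloisRepresentations.mem_absUpperRamificationSubgroup_iff.mp hσ) E
  have hψ : 0 < GaloisRepresentations.herbrandPsi 𝔓E (E ≃ₐ[K] E) u := by
    by_contra hle
    have hle' : GaloisRepresentations.herbrandPsi 𝔓E (E ≃ₐ[K] E) u ≤ 0 := le_of_not_gt hle
    have h1 := GaloisRepresentations.herbrandPhi_herbrandPsi_holds 𝔓E (E ≃ₐ[K] E) u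
    rw [GaloisRepresentations.herbrandPhi_of_nonpos 𝔓E hle'] at h1
    linarith
  have hs1 : GaloisRepresentations.absRestrictNormalHom E σ ∈ 𝔓E.ramificationSubgroup (E ≃ₐ[K] E) 1 :=
    Ideal.ramificationSubgroup_antitone 𝔓E (E ≃ₐ[K] E) (Nat.ceil_pos.mpr hψ) hs
  -- `G_1` is a `p`-group
  haveI : 𝔓.IsPrime := h𝔓.1
  have hp𝔓 : (p : GaloisRepresentations.absIntegers (𝓞 K) K) ∈ 𝔓 := by
    have h1 : (p : 𝓞 K) ∈ 𝔓.under (𝓞 K) := by rw [← h𝔓.2.over]; exact hpv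
    rw [Ideal.under_def, Ideal.mem_comap, map_natCast] at h1
    exact h1
  have hP : IsPGroup p (𝔓E.ramificationSubgroup (E ≃ₐ[K] E) 1) :=
    GaloisRepresentations.GaloisRep.isPGroup_ramificationSubgroup_comap_one (𝓞 K) 𝔓 E hp𝔓
  obtain ⟨k, hk⟩ := hP ⟨_, hs1⟩
  refine ⟨k, fun x ↦ ?_⟩
  have hker' : σ ^ p ^ k ∈ (GaloisRepresentations.absRestrictNormalHom (K := K) E).ker := by
    rw [MonoidHom.mem_ker, map_pow]
    have := congrArg Subtype.val hk
    simpa using this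
  have h1 : f₀ (σ ^ p ^ k) = 1 := by
    have := hker hker'
    rwa [MonoidHom.mem_ker] at this
  have := Equiv.congr_fun h1 x
  simpa [f₀] using this

/-- **Coprime-order automorphisms are detected on the `ℓ`-torsion.** Let a group `G` act on an
abelian group `A` by group automorphisms, `σ ∈ G`, `ℓ` and `N` coprime. If `σ` fixes `A[ℓ]`
pointwise and `σ ^ N` fixes `A[ℓ ^ n]` pointwise, then `σ` fixes `A[ℓ ^ n]` pointwise
(induction on the layers `A[ℓ^{i+1}] / A[ℓ^i] ↪ A[ℓ]`). [folklore] -/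
theorem smul_eq_self_of_pow_smul_eq_self_of_coprime {G A : Type*} [Group G] [AddCommGroup A]
    [DistribMulAction G A] {σ : G} {ℓ N n : ℕ} (hcop : N.Coprime ℓ)
    (h1 : ∀ a : A, ℓ • a = 0 → σ • a = a) (hN : ∀ a : A, ℓ ^ n • a = 0 → σ ^ N • a = a) :
    ∀ a : A, ℓ ^ n • a = 0 → σ • a = a := by
  -- `P i`: `σ` fixes `A[ℓ ^ i]`, for `i ≤ n`
  suffices h : ∀ i, i ≤ n → ∀ a : A, ℓ ^ i • a = 0 → σ • a = a from h n le_rfl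
  intro i
  induction i with
  | zero =>
    intro _ a ha
    rw [pow_zero, one_smul] at ha
    rw [ha, smul_zero]
  | succ i ih =>
    intro hi a ha
    have ih' := ih (Nat.le_of_succ_le hi)
    set Q := σ • a - a with hQ
    -- `Q ∈ A[ℓ ^ i]`, hence fixed by `σ`
    have hQi : ℓ ^ i • Q = 0 := by
      have hla : ℓ • (ℓ ^ i • a) = 0 := by rw [← mul_smul, ← pow_succ', ha]
      rw [hQ, smul_sub, smul_comm, h1 _ hla, sub_self]
    have hσQ : σ • Q = Q := ih' Q hQi
    -- `σ ^ m • a = a + m • Q`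
    have hiter : ∀ m : ℕ, σ ^ m • a = a + m • Q := by
      intro m
      induction m with
      | zero => rw [pow_zero, one_smul, zero_smul, add_zero]
      | succ m ihm =>
        rw [pow_succ', mul_smul, ihm, smul_add, smul_comm, hσQ, succ_nsmul, hQ]
        abel
    have han : ℓ ^ n • a = 0 := by
      obtain ⟨d, hd⟩ := Nat.exists_eq_add_of_le hi
      rw [hd, pow_add, mul_comm, mul_smul, ha, smul_zero]
    have hNQ : N • Q = 0 := by
      have := hiter N
      rw [hN a han] at this
      exact (add_eq_left.mp this.symm)
    -- `gcd (N, ℓ ^ i) = 1` kills `Q`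
    have hQ0 : Q = 0 := by
      have h1' : addOrderOf Q ∣ N := addOrderOf_dvd_of_nsmul_eq_zero hNQ
      have h2' : addOrderOf Q ∣ ℓ ^ i := addOrderOf_dvd_of_nsmul_eq_zero hQi
      have hg : addOrderOf Q ∣ Nat.gcd N (ℓ ^ i) := Nat.dvd_gcd h1' h2'
      rw [Nat.Coprime.gcd_eq_one (hcop.pow_right i), Nat.dvd_one] at hg
      exact AddMonoid.addOrderOf_eq_one_iff.mp hg
    rw [hQ, sub_eq_zero] at hQ0
    exact hQ0

/-- In a group, a non-trivial element killed by a power of a prime `p` has a power of order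
exactly `p`. [folklore] -/
theorem exists_orderOf_pow_eq_of_pow_prime_pow_eq_one {G : Type*} [Group G] {p : ℕ} (hp : p.Prime)
    {x : G} {k : ℕ} (hx : x ^ p ^ k = 1) (hx1 : x ≠ 1) : ∃ m : ℕ, orderOf (x ^ m) = p := by
  have hdvd : orderOf x ∣ p ^ k := orderOf_dvd_of_pow_eq_one hx
  obtain ⟨j, -, hj⟩ := (Nat.dvd_prime_pow hp).mp hdvd
  have hj0 : j ≠ 0 := by
    rintro rfl
    rw [pow_zero, orderOf_eq_one_iff] at hj
    exact hx1 hj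
  have hpd : p ∣ orderOf x := by rw [hj]; exact dvd_pow_self p hj0
  have hx0 : orderOf x ≠ 0 := by rw [hj]; exact pow_ne_zero _ hp.ne_zero
  exact ⟨orderOf x / p, orderOf_pow_orderOf_div hx0 hpd⟩

/-! ## Elliptic curves over `ℚ`: `27 ∣ N_E` forces an element of order `3` in `ρ̄_{E,5}(Γ_ℚ)` -/

/-- The Tate module: if `σ ∈ Γ_F` acts non-trivially on `V_p E = ℚ_p ⊗ T_p E` then it moves some
geometric `p ^ n`-torsion point (a component of an element of `T_p E`). [folklore] -/
theorem exists_smul_proj_ne_of_ne_one {F : Type u} [Field F] (W : WeierstrassCurve F)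
    (p : ℕ) [Fact p.Prime] {σ : absoluteGaloisGroup F}
    (h : EllipticCurves.rationalTateRepresentation (absoluteGaloisGroup F) (WeierstrassCurve.geomPoints W) p σ ≠ 1) :
    ∃ (n : ℕ) (x : EllipticCurves.TateModule (WeierstrassCurve.geomPoints W) p),
      σ • EllipticCurves.TateModule.proj p n x ≠ EllipticCurves.TateModule.proj p n x := by
  by_contra hall
  simp only [not_exists, not_not] at hall
  apply h
  have hT : ∀ x : EllipticCurves.TateModule (WeierstrassCurve.geomPoints W) p, σ • x = x := fun x ↦
    EllipticCurves.TateModule.ext fun n ↦ by rw [EllipticCurves.TateModule.proj_smul_of_distribMulAction]; exact hall n x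
  have h1 : EllipticCurves.tateRepresentation (absoluteGaloisGroup F) (WeierstrassCurve.geomPoints W) p σ = 1 :=
    LinearMap.ext fun x ↦ by rw [EllipticCurves.tateRepresentation_apply_apply, hT, Module.End.one_apply]
  change ((Module.End.baseChangeHom ℤ_[p] ℚ_[p]
    (EllipticCurves.TateModule (WeierstrassCurve.geomPoints W) p)).toMonoidHom.comp
    (EllipticCurves.tateRepresentation (absoluteGaloisGroup F) (WeierstrassCurve.geomPoints W) p)) σ = 1
  rw [MonoidHom.comp_apply, h1, map_one]

open WeierstrassCurve in
/-- If `ρ̄` is a framed model of `E[n]` and `σ` fixes `E[n]` pointwise then `ρ̄(σ) = 1`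
(the frame `E[n] ≃ (ℤ/n)²` is onto). [folklore] -/
theorem eq_one_of_forall_smul_eq {F : Type u} [Field F] {W : WeierstrassCurve F} {n : ℕ}
    {ρ : GaloisRepresentations.FramedGaloisRep F (ZMod n) 2} (hρ : W.IsTorsionGaloisRep n ρ)
    {σ : absoluteGaloisGroup F} (h : ∀ P : geomTorsion W n, σ • P = P) : ρ σ = 1 := by
  obtain ⟨e, he⟩ := hρ
  have hv : ∀ v : Fin 2 → ZMod n,
      ((ρ σ : GL (Fin 2) (ZMod n)) : Matrix (Fin 2) (Fin 2) (ZMod n)) *ᵥ v = v := by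
    intro v
    obtain ⟨P, rfl⟩ := e.surjective v
    rw [← he σ P, h P]
  refine Matrix.GeneralLinearGroup.ext fun i j ↦ ?_
  have hij := congrFun (hv (Pi.single j 1)) i
  rw [Matrix.mulVec_single_one] at hij
  change ((ρ σ : GL (Fin 2) (ZMod n)) : Matrix (Fin 2) (Fin 2) (ZMod n)) i j = _ at hij
  rw [hij, Units.val_one, Matrix.one_apply, Pi.single_apply]

open WeierstrassCurve in
/-- **The hidden lemma of CDT Thm. 7.2.4, arithmetic half.** For an elliptic curve `E / ℚ` with
`27 ∣ N_E`, the image of `ρ̄_{E,5}` contains an element of order `3` — granted Ogg–Saito in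
Galois form at `ℓ = 5` (the tree's named fact
`WeierstrassCurve.artinConductorExponent_tate_eq_conductorExponent_of_isElliptic W 5`, Serre–Tate
1968 §2.1, Silverman *ATAEC* IV.10.2/IV.11.1). CDT record the content as "the hypothesis on the
conductor of `E` [`27 ∤ N_E`] is satisfied if and only if `E` acquires semistable reduction over a
tamely ramified extension of `ℚ₃`" (Introduction, p. 522) and "since `ρ̄_{E',5} ≅ ρ̄_{E,5}` the
conductor of `E'` is not divisible by `27`" (proof of Thm. 7.1.2, p. 556). Proof: `27 ∣ N_E` means
`f₃(E) ≥ 3`, so the Artin exponent `a₃(V₅ E) = codim (V₅E)^{I} + Sw ≥ 3 > 2 = dim V₅ E`, so some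
`σ` in a wild group `Γ_ℚ^u` (`u > 0`) at a prime above `3` acts non-trivially on `V₅ E`, hence
moves a point of `E[5ⁿ]`; its action on the finite `Γ_ℚ`-set `E[5ⁿ]` has `3`-power order
(`Γ_ℚ^u ↠ Gal(L/ℚ)^u ≤ G₁`, a `3`-group), so by coprimality it already moves a point of `E[5]`:
`ρ̄(σ) ≠ 1` has `3`-power order. [cite: ConradDiamondTaylor1999, §7.2, proof of Thm. 7.1.2 (p. 556)] -/
theorem exists_orderOf_eq_three_of_dvd_conductorNorm (W : WeierstrassCurve ℚ) [W.IsElliptic]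
    (hOgg : W.artinConductorExponent_tate_eq_conductorExponent_of_isElliptic 5)
    {ρ : GaloisRepresentations.ModPGaloisRep ℚ (ZMod 5) 2} (hρ : W.IsTorsionGaloisRep 5 ρ)
    (h27 : 27 ∣ W.conductorNorm ℤ) : ∃ σ : absoluteGaloisGroup ℚ, orderOf (ρ σ) = 3 := by
  classical
  -- the places above `3`
  set p3 : Nat.Primes := ⟨3, Nat.prime_three⟩ with hp3
  set vZ : HeightOneSpectrum ℤ := (Rat.HeightOneSpectrum.primesEquiv (R := ℤ)).symm p3 with hvZ
  set v : HeightOneSpectrum (𝓞 ℚ) := (Rat.HeightOneSpectrum.primesEquiv (R := 𝓞 ℚ)).symm p3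
    with hv
  -- `f₃(E) ≥ 3`
  have hfZ : 3 ≤ W.conductorExponent vZ := by
    have hfac := factorization_conductorNorm_holds W vZ
    have hgen : Rat.HeightOneSpectrum.natGenerator vZ = 3 := by
      change ((Rat.HeightOneSpectrum.primesEquiv vZ : Nat.Primes) : ℕ) = 3
      rw [hvZ, Equiv.apply_symm_apply]
    rw [hgen] at hfac
    rw [← hfac, ← Nat.Prime.pow_dvd_iff_le_factorization Nat.prime_three
      (conductorNorm_pos_holds W).ne']
    norm_num
    exact h27
  have hf : 3 ≤ W.conductorExponent v := by
    rw [conductorExponent_ringOfIntegers_eq W v, hv, Equiv.apply_symm_apply]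
    exact hfZ
  -- `a₃(V₅ E) ≥ 3`
  have hcont : Continuous fun x : absoluteGaloisGroup ℚ × EllipticCurves.RationalTateModule (geomPoints W) 5 ↦
      EllipticCurves.rationalTateRepresentation (absoluteGaloisGroup ℚ) (geomPoints W) 5 x.1 x.2 :=
    continuous_rationalGaloisRepTate_holds W 5
  have h5 : ((5 : ℕ) : 𝓞 ℚ) ∉ v.asIdeal := by
    rw [EllipticCurves.natCast_mem_asIdeal_iff_eq_primesEquiv_symm v Nat.prime_five, hv,
      (Rat.HeightOneSpectrum.primesEquiv (R := 𝓞 ℚ)).symm.injective.eq_iff]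
    intro h
    have := congrArg Subtype.val h
    norm_num [hp3] at this
  have ha : EllipticCurves.conductorExponentOf (geomPoints W) 5 hcont v = W.conductorExponent v := hOgg hcont v h5
  set ρV := EllipticCurves.rationalTateGaloisRepOf (geomPoints W) 5 hcont with hρV
  haveI : Module.Finite ℚ_[5] (EllipticCurves.RationalTateModule (geomPoints W) 5) :=
    module_finite_rationalTateModule_holds W 5
  have hrank : Module.finrank ℚ_[5] (EllipticCurves.RationalTateModule (geomPoints W) 5) = 2 :=
    finrank_rationalTateModule_eq_two_holds W 5 (by norm_num)
  have ha3 : Module.finrank ℚ_[5] (EllipticCurves.RationalTateModule (geomPoints W) 5) <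
      ρV.artinConductorExponent v := by
    rw [hrank]
    change 2 < EllipticCurves.conductorExponentOf (geomPoints W) 5 hcont v
    rw [ha]
    exact hf
  -- a wild element acting non-trivially on `V₅ E`
  obtain ⟨u, hu, σ, hσu, hσV⟩ := exists_mem_absUpperRamificationSubgroup_ne_one ρV v ha3
  set 𝔓 := (HeightOneSpectrum.primesAbove_nonempty v).some with h𝔓def
  have h𝔓 : 𝔓 ∈ v.primesAbove := (HeightOneSpectrum.primesAbove_nonempty v).some_mem
  -- it moves a point of `E[5ⁿ]`
  obtain ⟨n, x, hn⟩ := exists_smul_proj_ne_of_ne_one W 5 hσV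
  set P : geomPoints W := EllipticCurves.TateModule.proj 5 n x with hPdef
  have hP : 5 ^ n • P = 0 :=
    AddSubgroup.torsionBy.nsmul_iff.mp (proj_tateModule_mem_geomTorsion W 5 n x)
  -- the action of `σ` on the finite `Γ_ℚ`-set `E[5ⁿ]` (open stabiliser) has `3`-power order
  set M := geomTorsion W ((5 ^ n : ℕ) : ℤ) with hM
  haveI : Finite M :=
    finite_torsionPoints_holds W (AlgebraicClosure ℚ) (n := ((5 ^ n : ℕ) : ℤ)) (by positivity)
  have hopen : IsOpen {τ : absoluteGaloisGroup ℚ | ∀ Q : M, τ • Q = Q} := by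
    have hset : {τ : absoluteGaloisGroup ℚ | ∀ Q : M, τ • Q = Q} =
        ⋂ Q : M, (MulAction.stabilizer (absoluteGaloisGroup ℚ) (Q : geomPoints W) : Set _) := by
      ext τ
      simp only [Set.mem_setOf_eq, Set.mem_iInter, SetLike.mem_coe, MulAction.mem_stabilizer_iff,
        Subtype.ext_iff]
      rfl
    rw [hset]
    exact isOpen_iInter_of_finite fun Q ↦ isOpen_stabilizer_point_holds W (Q : geomPoints W)
  have h3v : ((3 : ℕ) : 𝓞 ℚ) ∈ v.asIdeal := by
    rw [EllipticCurves.natCast_mem_asIdeal_iff_eq_primesEquiv_symm v Nat.prime_three]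
  obtain ⟨k, hk⟩ := exists_pow_prime_pow_smul_eq_self h𝔓 h3v hu hσu M hopen
  have hN : ∀ a : geomPoints W, 5 ^ n • a = 0 → σ ^ 3 ^ k • a = a := fun a ha ↦
    congrArg Subtype.val (hk ⟨a, AddSubgroup.torsionBy.nsmul_iff.mpr ha⟩)
  -- hence `σ` already moves a point of `E[5]`
  obtain ⟨P₁, hP₁5, hσP₁⟩ : ∃ P₁ : geomPoints W, 5 • P₁ = 0 ∧ σ • P₁ ≠ P₁ := by
    by_contra hall
    simp only [not_exists, not_and, not_not] at hall
    have hcop : (3 ^ k).Coprime 5 := Nat.Coprime.pow_left k (by norm_num)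
    exact hn (smul_eq_self_of_pow_smul_eq_self_of_coprime hcop hall hN P hP)
  -- `n ≥ 1`, so `E[5] ⊆ E[5ⁿ]`
  have hn1 : 1 ≤ n := by
    rcases Nat.eq_zero_or_pos n with h0 | h0
    · exfalso
      apply hn
      have hP0 : P = 0 := by rw [h0, pow_zero, one_smul] at hP; exact hP
      rw [hP0, smul_zero]
    · exact h0
  have h5n : ∀ a : geomPoints W, 5 • a = 0 → 5 ^ n • a = 0 := by
    intro a ha
    obtain ⟨d, hd⟩ := Nat.exists_eq_add_of_le hn1
    rw [hd, pow_add, pow_one, mul_comm, mul_smul, ha, smul_zero]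
  -- `ρ̄(σ) ≠ 1` has `3`-power order
  have hρ1 : ρ σ ≠ 1 := by
    intro h1
    apply hσP₁
    obtain ⟨e, he⟩ := hρ
    have h2 := he σ ⟨P₁, AddSubgroup.torsionBy.nsmul_iff.mpr hP₁5⟩
    rw [h1, Units.val_one, one_mulVec] at h2
    exact congrArg Subtype.val (e.injective h2)
  have hρN : (ρ σ) ^ 3 ^ k = 1 := by
    rw [← map_pow]
    refine eq_one_of_forall_smul_eq hρ fun Q ↦ Subtype.ext ?_
    exact hN Q (h5n Q (AddSubgroup.torsionBy.nsmul_iff.mp Q.2))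
  obtain ⟨m, hm⟩ := exists_orderOf_pow_eq_of_pow_prime_pow_eq_one Nat.prime_three hρN hρ1
  exact ⟨σ ^ m, by rw [map_pow]; exact hm⟩


/-! ## Assembly: CDT Theorem 7.2.4 from Theorems 7.1.2, 7.2.2 and Ogg–Saito -/

open WeierstrassCurve in
/-- **The hidden lemma of CDT Thm. 7.2.4** (Conrad–Diamond–Taylor 1999, p. 556 "immediate from
Theorem 7.1.2", with the proof of Lemma 7.2.3, p. 554, and the Introduction, p. 522): for an
elliptic curve `E / ℚ`, if `ρ̄_{E,5}|_{ℚ(√5)}` is **not** absolutely irreducible then `27 ∤ N_E` —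
granted Ogg–Saito in Galois form at `ℓ = 5` (hypothesis `hOgg`, the tree's named fact). Combines
the arithmetic half `exists_orderOf_eq_three_of_dvd_conductorNorm` with the group-theoretic half
`isAbsIrreducibleOverSqrt_five_of_orderOf_eq_three`, the determinant input `det ρ̄_{E,5} = χ̄₅`
being the tree's theorem `det_eq_modPCyclotomicCharacter_of_isTorsionGaloisRep_holds` (Weil
pairing). [cite: ConradDiamondTaylor1999, Thm. 7.2.4 (p. 556) with proof of Lemma 7.2.3 (p. 554)] -/
theorem not_dvd_conductorNorm_of_not_isAbsIrreducibleOverSqrt (W : WeierstrassCurve ℚ)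
    [W.IsElliptic] (hOgg : W.artinConductorExponent_tate_eq_conductorExponent_of_isElliptic 5)
    {ρ : GaloisRepresentations.ModPGaloisRep ℚ (ZMod 5) 2} (hρ : W.IsTorsionGaloisRep 5 ρ)
    (h : ¬ ρ.IsAbsIrreducibleOverSqrt 5) : ¬ 27 ∣ W.conductorNorm ℤ := by
  intro h27
  obtain ⟨σ, hσ⟩ := exists_orderOf_eq_three_of_dvd_conductorNorm W hOgg hρ h27
  exact h (isAbsIrreducibleOverSqrt_five_of_orderOf_eq_three ρ
    (W.det_eq_modPCyclotomicCharacter_of_isTorsionGaloisRep_holds 5 ρ hρ) hσ)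

open WeierstrassCurve in
/-- **Conrad–Diamond–Taylor 1999, Theorem 7.2.4 from Theorems 7.1.2 and 7.2.2** (JAMS 12 (1999),
p. 556: "we record the following strengthening of Theorem 7.2.2, immediate from Theorem 7.1.2"),
PROVED as printed, granted the named facts `CDT_theorem_7_1_2`, `CDT_theorem_7_2_2`
(`BCDTModularity`, Part 4) and Ogg–Saito in Galois form at `ℓ = 5` for every `E / ℚ` (`hOgg`):
if `ρ̄_{E,5}|_{ℚ(√5)}` is absolutely irreducible, the hypothesis of 7.2.4 says `ρ̄_{E,5}` is
modular and `E` is modular by Thm. 7.2.2; otherwise `27 ∤ N_E`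
(`not_dvd_conductorNorm_of_not_isAbsIrreducibleOverSqrt`) and `E` is modular by Thm. 7.1.2.
[cite: ConradDiamondTaylor1999, Thm. 7.2.4] -/
theorem CDT_theorem_7_2_4_of_7_1_2_of_7_2_2 (h712 : CDT_theorem_7_1_2) (h722 : CDT_theorem_7_2_2)
    (hOgg : ∀ W : WeierstrassCurve ℚ,
      W.artinConductorExponent_tate_eq_conductorExponent_of_isElliptic 5) :
    CDT_theorem_7_2_4 := by
  intro W _ _ ρ hρ hyp
  by_cases habs : ρ.IsAbsIrreducibleOverSqrt 5
  · have hmod : ρ.IsModular := hyp.resolve_right (not_not_intro habs)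
    exact h722 W ρ hρ habs hmod
  · exact h712 W (not_dvd_conductorNorm_of_not_isAbsIrreducibleOverSqrt W (hOgg W) hρ habs)

open WeierstrassCurve in
/-- **BCDT Theorem 2.2.2 for a given `E`, from Theorem B, CDT Thms. 7.1.2, 7.2.2 and Ogg–Saito**
(`isModular_of_theoremB_of_CDT` of `BCDTModularity` Part 3 with `CDT_theorem_7_2_4` discharged by
`CDT_theorem_7_2_4_of_7_1_2_of_7_2_2`). [cite: BCDTJAMS2001, Theorem 2.2.2] -/
theorem isModular_of_theoremB_of_CDT712_722 (hB : theoremB) (h712 : CDT_theorem_7_1_2)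
    (h722 : CDT_theorem_7_2_2)
    (hOgg : ∀ W : WeierstrassCurve ℚ,
      W.artinConductorExponent_tate_eq_conductorExponent_of_isElliptic 5)
    (W : WeierstrassCurve ℚ) [W.IsElliptic] [NeZero (W.conductorNorm ℤ)] : IsModular W :=
  isModular_of_theoremB_of_CDT hB (CDT_theorem_7_2_4_of_7_1_2_of_7_2_2 h712 h722 hOgg) W

/-- **BCDT Theorem A** (`Literature.NumberTheory.EllipticCurves.ModularForms.exists_isNewformOf`, the Modularity Theorem in the
tree's form) **from Theorem B, CDT Thms. 7.1.2 and 7.2.2, and Ogg–Saito for `V₅ E`** — the trust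
base of the Modularity Theorem in the tree after this file. [cite: BCDTJAMS2001, Theorem A] -/
theorem exists_isNewformOf_of_theoremB_of_CDT712_722 (hB : theoremB) (h712 : CDT_theorem_7_1_2)
    (h722 : CDT_theorem_7_2_2)
    (hOgg : ∀ W : WeierstrassCurve ℚ,
      W.artinConductorExponent_tate_eq_conductorExponent_of_isElliptic 5) :
    EllipticCurves.ModularForms.exists_isNewformOf :=
  exists_isNewformOf_of_theoremB_of_CDT hB (CDT_theorem_7_2_4_of_7_1_2_of_7_2_2 h712 h722 hOgg)

end Literature.NumberTheory.Automorphic.BCDT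

/-! ## lang.S33 from Theorem B, CDT Thms. 7.1.2 and 7.2.2, and Ogg–Saito -/

namespace Literature.NumberTheory.Automorphic

/-- **lang.S33 from Theorem B, CDT Thms. 7.1.2, 7.2.2 and Ogg–Saito**: granted the named facts
`Literature.NumberTheory.Automorphic.BCDT.theoremB` (BCDT 2001, Thm. B), `Literature.NumberTheory.Automorphic.BCDT.CDT_theorem_7_1_2`, `Literature.NumberTheory.Automorphic.BCDT.CDT_theorem_7_2_2`
(CDT 1999) and Ogg–Saito in Galois form at `ℓ = 5`
(`WeierstrassCurve.artinConductorExponent_tate_eq_conductorExponent_of_isElliptic · 5`), every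
elliptic `E / ℚ` has a cusp form `f ∈ S₂(Γ₀(N))` with `a_p(f) = p + 1 - #E(𝔽_p)` for
`p ∤ N Δ_E` (Part 2 of `LangWave0Proofs` applied to
`Literature.NumberTheory.Automorphic.BCDT.exists_isNewformOf_of_theoremB_of_CDT712_722`). [cite: BCDTJAMS2001, Theorem 2.2.2] -/
theorem exists_cuspForm_coeff_eq_frobeniusTrace_of_theoremB_of_CDT712_722 (hB : Literature.NumberTheory.Automorphic.BCDT.theoremB)
    (h712 : Literature.NumberTheory.Automorphic.BCDT.CDT_theorem_7_1_2) (h722 : Literature.NumberTheory.Automorphic.BCDT.CDT_theorem_7_2_2)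
    (hOgg : ∀ W : WeierstrassCurve ℚ,
      W.artinConductorExponent_tate_eq_conductorExponent_of_isElliptic 5) :
    exists_cuspForm_coeff_eq_frobeniusTrace :=
  exists_cuspForm_coeff_eq_frobeniusTrace_of_exists_isNewformOf
    (Literature.NumberTheory.Automorphic.BCDT.exists_isNewformOf_of_theoremB_of_CDT712_722 hB h712 h722 hOgg)

/-- **The `L`-series form of lang.S33 from Theorem B, CDT Thms. 7.1.2, 7.2.2 and Ogg–Saito.**
[cite: BCDTJAMS2001, Theorem 2.2.2] -/
theorem exists_cuspForm_qExpansion_coeff_eq_lFunction_of_theoremB_of_CDT712_722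
    (hB : Literature.NumberTheory.Automorphic.BCDT.theoremB) (h712 : Literature.NumberTheory.Automorphic.BCDT.CDT_theorem_7_1_2)
    (h722 : Literature.NumberTheory.Automorphic.BCDT.CDT_theorem_7_2_2)
    (hOgg : ∀ W : WeierstrassCurve ℚ,
      W.artinConductorExponent_tate_eq_conductorExponent_of_isElliptic 5) :
    exists_cuspForm_qExpansion_coeff_eq_lFunction :=
  exists_cuspForm_qExpansion_coeff_eq_lFunction_of_exists_isNewformOf
    (Literature.NumberTheory.Automorphic.BCDT.exists_isNewformOf_of_theoremB_of_CDT712_722 hB h712 h722 hOgg)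

end Literature.NumberTheory.Automorphic

end
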